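import Literature.MathematicalPhysics.QuantumFieldTheory.CvitanovicKinoshita1974.SubdiagramUVLimits
import HarnessLib

/-!
# The remainders of the K-operation's UV limit gain one power of `ε`: `U − U_S U_{G/S} = O(ε^{n_S+1})` and `V − V_S − V_{G/S} = O(ε)`, i.e. the numerator `(UV)_G U_S U_{G/S} − (UV)_S U_G U_{G/S} − (UV)_{G/S} U_G U_S = O(ε^{2 n_S + 1})` (AHKN 2006 §3.1–§3.3; Cvitanović–Kinoshita 1974 II (2.11), (2.17)) — PROVED in the loop-matrix form

independent recomputation; certified where stated, statistical where stated; no new-physics claim.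

HONEST FRAMING (venture `QEDPrecision`, cell `qed-hepp`, seat `qed-hepp-lit` gen 4; VALUE-FREE: divisibility statements between polynomial
expressions in the entries of arbitrary integer matrices and arbitrary parameters of a commutative ring — no graph, no integral, no number of any
Set-V family). Purpose: the cell's theory seat books the gain of the UV Taylor remainder `(1 − K_h)` as a DEGREE statement on the two
denominator polynomials (HOME/theory/BOUNDEDNESS.md §6.2 RULE R-K, §6.5, §14 «GAP-RK»): `R_U := U_G − U_h U_{G/h}` has `z_h`-degree `≥ n_h + 1`
(critical degree `n_h`) and the «Δ_h-numerator» `DNUM := (UV)_G·U_h U_{G/h} − (UV)_h·U_G U_{G/h} − (UV)_{G/h}·U_G U_h` has `z_h`-degree `≥ 2 n_h + 1`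
(critical `2 n_h`), so that `Δ_h = V_G − V_h − V_{G/h} = DNUM/(U_G U_h U_{G/h})` gains one power — the first PROVED there, the second CHECKED by exact
integer arithmetic on all twelve CORE-prototype subdiagrams with «general proof open». Both are the PRINTED UV-limit theorems read as statements about
the remainder: `U = ε^{n_S}(U_S U_{G/S} + O(ε))` (AHKN §3.3, C-K II (2.11)) and `V = V_{G/S} + O(ε)`, `V_S = O(ε)` (C-K II (2.17); AHKN §3.2 «Since V_S
is a higher order term in ε, its addition … does not affect the UV-limit»). This file proves them in the vocabulary of `BuildingBlockUVLimits` /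
`SubdiagramUVLimits`, for an arbitrary `S`-adapted fundamental set of circuits, arbitrary masses and arbitrary `p²` (hence also on the mass shell).

SOURCES, AS PRINTED.
* [AoyamaEtAl2006] T. Aoyama, M. Hayakawa, T. Kinoshita, M. Nio, Nucl. Phys. B 740 (2006) 138 = arXiv:hep-ph/0512288 (`lit read
  paper:arxiv-hep-ph_0512288`, chunks pNNNN:Lk). §3.1 (p0010:L118–L170): «z_i = O(ε) (i ∈ S), O(1) (otherwise) … U = O(ε^{n_S}), V = O(1) … Let us
  denote the UV limit of U and B_ij as [U]^S_UV and [B_ij]^S_UV»; §3.2 (p0011:L7–L37): «The K-operation K_S is defined as follows. … Replace U, B_ij,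
  C_ij, and A_i appearing in the integrand with their UV-limits … Replace V with V_S + V_{G/S}, where V_S and V_{G/S} are V functions of S and G/S,
  respectively. … A naïve UV-limit gives V → V_{G/S} instead … Since V_S is a higher order term in ε, its addition … does not affect the UV-limit.»;
  §3.3 (p0011:L55–L60): «[U]^S_UV = U_S U_{G/S} (= O(ε^{n_S}))»; §2.2 (p0006:L155–L161): «V = Σ z_i (m_i² − q_i·Q′_i), Q′_i = −(1/U) Σ_j q_j z_j B′_ij,
  B′_ij = B_ij − δ_ij U/z_j».
* [CvitanovicKinoshita1974b] P. Cvitanović, T. Kinoshita, Phys. Rev. D 10 (1974) 3991, §II B eq. (2.11) «[U]^S_UV = U_S U_{G/S}», eq. (2.17)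
  «[V(p)]^S_UV = V_{G/S}(p)» (typed: `SubdiagramUVLimits.uvV_zero`).

TYPING. As in `BuildingBlockUVLimits` (`adaptedT TI TOS TOO`, inner circuits `κI`, `n_S = |κI|`, lines `μS ⊕ μO`, UV scaling `scaledZ zS zO ε =
(ε·zS, zO)`) and `SubdiagramIRLimits`/`SubdiagramUVLimits` (`VNum T z msq χ psq = U·V` with one external momentum of square `psq` routed with
incidence `χ`; `G` carries `uvχ χS χO`, `S` carries `χS`, `G/S` carries `χO`; masses `msq` on `G`, restricted to `S` and to `G/S`). The three
polynomials of `R_U` and `DNUM` are functions of the SAME parameter vector, so under the scaling the `S`-polynomials are evaluated at `ε·zS`: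
`U_S(ε zS) = ε^{n_S} U_S(zS)`, `(UV)_S(ε zS) = ε^{n_S+1} (UV)_S(zS)` (homogeneity, proved). «`f(ε) = O(ε^k)`» is typed as DIVISIBILITY `ε^k ∣ f(ε)`
in the ring, for an arbitrary element `ε` of an arbitrary commutative ring `R` — with `R = R₀[X]`, `ε = X` this is «every monomial has
`z_S`-degree ≥ k», the form BOUNDEDNESS.md §6.5 checks.
PROVED (0 named facts). Homogeneity: `UMat_smul`, `UDet_smul` (`U(εz) = ε^n U(z)`), `WVec_smul`, `GQuad_smul`, `VNum_smul` (`(UV)(εz) = ε^{n+1}(UV)(z)`,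
`n ≥ 1`). Reduction modulo `ε` (for any ring map `π` with `π ε = 0`): `map_det_cofMat_of_map_eps` (`π det M(ε) = π det M(0)`), `map_uvG_of_map_eps`,
`map_uvV_of_map_eps`. **`RU_dvd`: `ε^{n_S+1} ∣ U_G(ε zS, zO) − U_S(ε zS)·U_{G/S}(zO)`** (= GAP-RK (i), the PROVED half, re-proved here);
**`DNUM_dvd`: `ε^{2 n_S + 1} ∣ (UV)_G·U_S U_{G/S} − (UV)_S·U_G U_{G/S} − (UV)_{G/S}·U_G U_S`** at `(ε zS, zO)`, `n_S ≥ 1`, arbitrary masses and `p²`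
(= GAP-RK (ii) / §6.5 (ii) «min z_S-degree = 2 n_h + 1 … proof still open in general» — the lower bound, for every `S`-adapted loop matrix).
NOT CLAIMED: that the degree is EXACTLY `n_S + 1` / `2 n_S + 1` (the checked minima), the sign statements of §6.5 (coefficient-wise `R_U ≥ 0`, `DNUM ≥ 0`
for self-energies), anything about numerators `F`, and the graph dictionary (which loop matrix belongs to which diagram: see `QTypeSubdiagrams`).
-/

namespace Literature.MathematicalPhysics.QuantumFieldTheory.AoyamaEtAl2006

open Matrix Finset
open Literature.MathematicalPhysics.QuantumFieldTheory.CvitanovicKinoshita1974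

/-! ## Homogeneity of the loop-matrix building blocks -/

section Homogeneity

variable {R : Type*} [CommRing R] {κ μ : Type*} [Fintype κ] [Fintype μ] [DecidableEq κ] [DecidableEq μ]

omit [Fintype κ] [DecidableEq κ] [DecidableEq μ] in
/-- `U_st(ε z) = ε · U_st(z)`. [cite: AoyamaEtAl2006, §2.3 (U_st linear in the z)] -/
theorem UMat_smul (T : Matrix κ μ ℤ) (z : μ → R) (ε : R) : UMat T (fun b => ε * z b) = ε • UMat T z := by
  ext s t
  simp only [UMat, Matrix.smul_apply, smul_eq_mul, Finset.mul_sum]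
  exact Finset.sum_congr rfl fun b _ => by ring

omit [DecidableEq μ] in
/-- **`U` is homogeneous of degree `n`** (the number of circuits): `U(ε z) = ε^n · U(z)` («U and B_ij are homogeneous polynomials of degree n and
n−1»). [cite: AoyamaEtAl2006, §2.2–§2.3] -/
theorem UDet_smul (T : Matrix κ μ ℤ) (z : μ → R) (ε : R) : UDet T (fun b => ε * z b) = ε ^ Fintype.card κ * UDet T z := by
  rw [UDet, UMat_smul, det_smul, UDet]

omit [Fintype κ] [DecidableEq κ] [DecidableEq μ] in
/-- `w(ε z) = ε · w(z)` for the flux vector. [cite: CvitanovicKinoshita1974a, §III eq. (26)] -/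
theorem WVec_smul (T : Matrix κ μ ℤ) (z χ : μ → R) (ε : R) : WVec T (fun b => ε * z b) χ = ε • WVec T z χ := by
  funext s
  simp only [WVec_apply, Pi.smul_apply, smul_eq_mul, Finset.mul_sum]
  exact Finset.sum_congr rfl fun b _ => by ring

omit [DecidableEq μ] in
/-- `wᵀ adj(U_st) w` is homogeneous of degree `n + 1` (`n ≥ 1`): `(εw)ᵀ adj(ε U_st) (εw) = ε · ε^{n−1} · ε · wᵀ adj(U_st) w`.
[cite: CvitanovicKinoshita1974a, §III eqs. (26)–(27)] -/
theorem GQuad_smul (hκ : 0 < Fintype.card κ) (T : Matrix κ μ ℤ) (z χ : μ → R) (ε : R) :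
    GQuad T (fun b => ε * z b) χ = ε ^ (Fintype.card κ + 1) * GQuad T z χ := by
  have hpow : ε * ε ^ (Fintype.card κ - 1) * ε = ε ^ (Fintype.card κ + 1) := by
    rw [← pow_succ', Nat.sub_add_cancel hκ, ← pow_succ]
  rw [GQuad, WVec_smul, UMat_smul, adjugate_smul, smul_mulVec, mulVec_smul, smul_dotProduct, dotProduct_smul, dotProduct_smul, smul_smul,
    smul_smul, smul_eq_mul, hpow, GQuad]

omit [DecidableEq μ] in
/-- **`U·V` is homogeneous of degree `n + 1`** (`n ≥ 1`; arbitrary masses and `p²`): `(UV)(ε z) = ε^{n+1} · (UV)(z)` — `V` is homogeneous of degree 1.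
[cite: AoyamaEtAl2006, §2.2 (eq. for V); CvitanovicKinoshita1974a §III eq. (26)] -/
theorem VNum_smul (hκ : 0 < Fintype.card κ) (T : Matrix κ μ ℤ) (z msq χ : μ → R) (psq ε : R) :
    VNum T (fun b => ε * z b) msq χ psq = ε ^ (Fintype.card κ + 1) * VNum T z msq χ psq := by
  have h1 : ∑ b, ε * z b * msq b = ε * ∑ b, z b * msq b := by
    rw [Finset.mul_sum]
    exact Finset.sum_congr rfl fun b _ => by ring
  have h2 : ∑ b, χ b * χ b * (ε * z b) = ε * ∑ b, χ b * χ b * z b := by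
    rw [Finset.mul_sum]
    exact Finset.sum_congr rfl fun b _ => by ring
  rw [VNum, VNum, UDet_smul, GQuad_smul hκ, h1, h2, pow_succ]
  ring

end Homogeneity

/-! ## Reduction modulo `ε`: the scaled blocks agree with their `ε = 0` values under any ring map killing `ε` -/

section ModEps

variable {R : Type*} [CommRing R] {R' : Type*} [CommRing R']
variable {κI κO μS μO : Type*} [Fintype κI] [Fintype κO] [Fintype μS] [Fintype μO] [DecidableEq κI] [DecidableEq κO]
variable (TI : Matrix κI μS ℤ) (TOS : Matrix κO μS ℤ) (TOO : Matrix κO μO ℤ) (zS : μS → R) (zO : μO → R)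
  (χS : μS → R) (χO : μO → R)

/-- `M(ε) ≡ M(0)` entrywise modulo `ε` (`M(ε) = M(0) + ε·N`). [cite: AoyamaEtAl2006, §3.3 (block form of U_st)] -/
theorem mapMatrix_cofMat_of_map_eps (π : R →+* R') {ε : R} (hε : π ε = 0) :
    π.mapMatrix (cofMat TI TOS TOO zS zO ε) = π.mapMatrix (cofMat TI TOS TOO zS zO 0) := by
  ext (s | s) (t | t)
  · simp [cofMat]
  · simp [cofMat]
  · simp [cofMat, hε]
  · simp [cofMat, hε]

/-- `det M(ε) ≡ det M(0) (mod ε)`. [cite: AoyamaEtAl2006, §3.3] -/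
theorem map_det_cofMat_of_map_eps (π : R →+* R') {ε : R} (hε : π ε = 0) :
    π (cofMat TI TOS TOO zS zO ε).det = π (cofMat TI TOS TOO zS zO 0).det := by
  rw [RingHom.map_det, RingHom.map_det, mapMatrix_cofMat_of_map_eps TI TOS TOO zS zO π hε]

omit [Fintype κI] [Fintype κO] [DecidableEq κI] [DecidableEq κO] in
/-- The scaled flux vector `w(ε) ≡ w(0) (mod ε)`. [cite: CvitanovicKinoshita1974b, §II B eq. (2.17) (derivation)] -/
theorem map_WVec_uv_of_map_eps (π : R →+* R') {ε : R} (hε : π ε = 0) :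
    π ∘ WVec (adaptedT TI TOS TOO) (scaledZ zS zO ε) (uvχ χS χO) = π ∘ WVec (adaptedT TI TOS TOO) (scaledZ zS zO 0) (uvχ χS χO) := by
  funext s
  rw [WVec_uv, WVec_uv]
  rcases s with s | s
  · simp [hε]
  · simp [hε]

omit [Fintype κI] [Fintype κO] [DecidableEq κI] [DecidableEq κO] in
/-- The reduced flux vector `ŵ(ε) ≡ ŵ(0) (mod ε)`. [cite: CvitanovicKinoshita1974b, §II B eq. (2.17) (derivation)] -/
theorem map_uvW_of_map_eps (π : R →+* R') {ε : R} (hε : π ε = 0) :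
    π ∘ uvW TI TOS TOO zS zO χS χO ε = π ∘ uvW TI TOS TOO zS zO χS χO 0 := by
  funext s
  rcases s with s | s
  · simp [uvW]
  · simp [uvW, hε]

/-- `uvG(ε) ≡ uvG(0) (mod ε)`. [cite: CvitanovicKinoshita1974b, §II B eq. (2.17)] -/
theorem map_uvG_of_map_eps (π : R →+* R') {ε : R} (hε : π ε = 0) :
    π (uvG TI TOS TOO zS zO χS χO ε) = π (uvG TI TOS TOO zS zO χS χO 0) := by
  have hmv : ∀ (ε' : R), π ∘ ((cofMat TI TOS TOO zS zO ε').adjugate *ᵥ uvW TI TOS TOO zS zO χS χO ε') =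
      (π.mapMatrix (cofMat TI TOS TOO zS zO ε')).adjugate *ᵥ (π ∘ uvW TI TOS TOO zS zO χS χO ε') := by
    intro ε'
    funext i
    rw [Function.comp_apply, RingHom.map_mulVec, ← RingHom.mapMatrix_apply, RingHom.map_adjugate]
  rw [uvG, uvG, RingHom.map_dotProduct, RingHom.map_dotProduct, hmv, hmv, map_WVec_uv_of_map_eps TI TOS TOO zS zO χS χO π hε,
    map_uvW_of_map_eps TI TOS TOO zS zO χS χO π hε, mapMatrix_cofMat_of_map_eps TI TOS TOO zS zO π hε]

/-- `uvV(ε) ≡ uvV(0) (mod ε)` (the cofactor polynomial of `U·V` under the UV scaling). [cite: CvitanovicKinoshita1974b, §II B eq. (2.17)] -/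
theorem map_uvV_of_map_eps (π : R →+* R') {ε : R} (hε : π ε = 0) (msq : μS ⊕ μO → R) (psq : R) :
    π (uvV TI TOS TOO zS zO χS χO msq psq ε) = π (uvV TI TOS TOO zS zO χS χO msq psq 0) := by
  have h1 : π (∑ c, scaledZ zS zO ε c * msq c) = π (∑ c, scaledZ zS zO 0 c * msq c) := by
    rw [map_sum, map_sum, Fintype.sum_sum_type, Fintype.sum_sum_type]
    simp [scaledZ, hε]
  have h2 : π (∑ c, uvχ χS χO c * uvχ χS χO c * scaledZ zS zO ε c) = π (∑ c, uvχ χS χO c * uvχ χS χO c * scaledZ zS zO 0 c) := by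
    rw [map_sum, map_sum, Fintype.sum_sum_type, Fintype.sum_sum_type]
    simp [scaledZ, hε]
  simp only [uvV, map_sub, map_mul, h1, h2, map_det_cofMat_of_map_eps TI TOS TOO zS zO π hε, map_uvG_of_map_eps TI TOS TOO zS zO χS χO π hε]

end ModEps

/-! ## The remainders: `R_U = O(ε^{n_S+1})`, `DNUM = O(ε^{2n_S+1})` -/

section Remainders

variable {R : Type*} [CommRing R]
variable {κI κO μS μO : Type*} [Fintype κI] [Fintype κO] [Fintype μS] [Fintype μO] [DecidableEq κI] [DecidableEq κO]
variable (TI : Matrix κI μS ℤ) (TOS : Matrix κO μS ℤ) (TOO : Matrix κO μO ℤ) (zS : μS → R) (zO : μO → R)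
  (χS : μS → R) (χO : μO → R)

/-- An element killed by the quotient map modulo `ε` is a multiple of `ε`. [folklore] -/
private theorem dvd_of_mk_eq_zero {ε x : R} (h : Ideal.Quotient.mk (Ideal.span {ε}) x = 0) : ε ∣ x := by
  obtain ⟨a, ha⟩ := Ideal.mem_span_singleton'.1 (Ideal.Quotient.eq_zero_iff_mem.1 h)
  exact ⟨a, by rw [← ha, mul_comm]⟩

/-- `R_U` factorised: `U_G(ε zS, zO) − U_S(ε zS)·U_{G/S}(zO) = ε^{n_S} · (det M(ε) − det M(0))`.
[cite: AoyamaEtAl2006, §3.3 (eq. [U]^S_UV = U_S U_{G/S}); CvitanovicKinoshita1974b §II B eq. (2.11)] -/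
theorem RU_eq (ε : R) :
    UDet (adaptedT TI TOS TOO) (scaledZ zS zO ε) - UDet TI (fun b => ε * zS b) * UDet TOO zO =
      ε ^ Fintype.card κI * ((cofMat TI TOS TOO zS zO ε).det - (cofMat TI TOS TOO zS zO 0).det) := by
  rw [UDet_adapted, UDet_smul, det_cofMat_zero]
  ring

/-- **`R_U = U_G − U_S U_{G/S} = O(ε^{n_S+1})`**: under «z_i = O(ε), i ∈ S» the remainder of `[U]^S_UV = U_S U_{G/S}` is divisible by `ε^{n_S+1}`
(BOUNDEDNESS.md §6.5 (i): «R_U … min z_S-degree = n_h + 1 (critical n_h)» — the lower bound, for every `S`-adapted loop matrix).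
[cite: AoyamaEtAl2006, §3.1 and §3.3; CvitanovicKinoshita1974b §II B eq. (2.11)] -/
theorem RU_dvd (ε : R) :
    ε ^ (Fintype.card κI + 1) ∣ UDet (adaptedT TI TOS TOO) (scaledZ zS zO ε) - UDet TI (fun b => ε * zS b) * UDet TOO zO := by
  have hq : ε ∣ (cofMat TI TOS TOO zS zO ε).det - (cofMat TI TOS TOO zS zO 0).det := by
    refine dvd_of_mk_eq_zero ?_
    rw [map_sub, map_det_cofMat_of_map_eps TI TOS TOO zS zO (Ideal.Quotient.mk (Ideal.span {ε}))
      (Ideal.Quotient.eq_zero_iff_mem.2 (Ideal.mem_span_singleton_self ε)), sub_self]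
  rw [RU_eq, pow_succ]
  exact mul_dvd_mul_left _ hq

/-- **The «Δ_h-numerator»** `DNUM := (UV)_G·U_S U_{G/S} − (UV)_S·U_G U_{G/S} − (UV)_{G/S}·U_G U_S`, the numerator of `V_G − V_S − V_{G/S}` over the
common denominator `U_G U_S U_{G/S}`, evaluated at the scaled parameters `(ε zS, zO)`; masses `msq` and `p²` arbitrary, `S` with the restricted
masses and the path incidence `χS`, `G/S` with `χO`. [cite: AoyamaEtAl2006, §3.2 (step «Replace V with V_S + V_{G/S}»)] -/
def DNUM (msq : μS ⊕ μO → R) (psq ε : R) : R :=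
  VNum (adaptedT TI TOS TOO) (scaledZ zS zO ε) msq (uvχ χS χO) psq * (UDet TI (fun b => ε * zS b) * UDet TOO zO)
    - VNum TI (fun b => ε * zS b) (fun b => msq (Sum.inl b)) χS psq * (UDet (adaptedT TI TOS TOO) (scaledZ zS zO ε) * UDet TOO zO)
    - VNum TOO zO (fun c => msq (Sum.inr c)) χO psq * (UDet (adaptedT TI TOS TOO) (scaledZ zS zO ε) * UDet TI (fun b => ε * zS b))

/-- The cofactor of `DNUM`: `DNUM(ε) = ε^{2 n_S} · dnumCof(ε)`. [cite: AoyamaEtAl2006, §3.2–§3.3] -/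
def dnumCof (msq : μS ⊕ μO → R) (psq ε : R) : R :=
  uvV TI TOS TOO zS zO χS χO msq psq ε * (UDet TI zS * UDet TOO zO)
    - ε * VNum TI zS (fun b => msq (Sum.inl b)) χS psq * ((cofMat TI TOS TOO zS zO ε).det * UDet TOO zO)
    - VNum TOO zO (fun c => msq (Sum.inr c)) χO psq * ((cofMat TI TOS TOO zS zO ε).det * UDet TI zS)

/-- `DNUM(ε) = ε^{2 n_S} · dnumCof(ε)` (`n_S ≥ 1`): the orders `(UV)_G = ε^{n_S} uvV`, `U_G = ε^{n_S} det M`, `U_S(εz) = ε^{n_S} U_S`,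
`(UV)_S(εz) = ε^{n_S+1}(UV)_S`. [cite: AoyamaEtAl2006, §3.1 («U = O(ε^{n_S}), V = O(1)»)] -/
theorem DNUM_eq (hI : 0 < Fintype.card κI) (msq : μS ⊕ μO → R) (psq ε : R) :
    DNUM TI TOS TOO zS zO χS χO msq psq ε = ε ^ (2 * Fintype.card κI) * dnumCof TI TOS TOO zS zO χS χO msq psq ε := by
  rw [DNUM, dnumCof, VNum_uv TI TOS TOO zS zO χS χO hI, UDet_adapted, UDet_smul, VNum_smul hI, two_mul, pow_add, pow_succ]
  ring

/-- **The leading coefficient cancels: `dnumCof(0) = 0`** — `uvV(0) = U_S (UV)_{G/S}` ((2.17) «[V]^S_UV = V_{G/S}») against `det M(0) = U_S U_{G/S}`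
((2.11)), the `(UV)_S` term carrying an explicit `ε` («V_S is a higher order term in ε»).
[cite: CvitanovicKinoshita1974b, §II B eqs. (2.11), (2.17); AoyamaEtAl2006 §3.2] -/
theorem dnumCof_zero (msq : μS ⊕ μO → R) (psq : R) : dnumCof TI TOS TOO zS zO χS χO msq psq 0 = 0 := by
  rw [dnumCof, uvV_zero, det_cofMat_zero]
  ring

/-- `dnumCof(ε) ≡ dnumCof(0) = 0 (mod ε)`, hence `ε ∣ dnumCof(ε)`. [cite: CvitanovicKinoshita1974b, §II B eq. (2.17); AoyamaEtAl2006 §3.2] -/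
theorem eps_dvd_dnumCof (msq : μS ⊕ μO → R) (psq ε : R) : ε ∣ dnumCof TI TOS TOO zS zO χS χO msq psq ε := by
  have hε : Ideal.Quotient.mk (Ideal.span {ε}) ε = 0 := Ideal.Quotient.eq_zero_iff_mem.2 (Ideal.mem_span_singleton_self ε)
  refine dvd_of_mk_eq_zero ?_
  have h := congrArg (Ideal.Quotient.mk (Ideal.span {ε})) (dnumCof_zero TI TOS TOO zS zO χS χO msq psq)
  rw [map_zero] at h
  rw [← h, dnumCof, dnumCof]
  simp only [map_sub, map_mul, map_zero, hε, zero_mul, map_uvV_of_map_eps TI TOS TOO zS zO χS χO _ hε,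
    map_det_cofMat_of_map_eps TI TOS TOO zS zO _ hε]

/-- **`DNUM = O(ε^{2 n_S + 1})`: `V_G − V_S − V_{G/S}` gains one power of `ε` in the UV limit of `S`** — for every `S`-adapted loop matrix with
`n_S ≥ 1`, arbitrary masses and `p²`: `ε^{2n_S+1} ∣ (UV)_G·U_S U_{G/S} − (UV)_S·U_G U_{G/S} − (UV)_{G/S}·U_G U_S` at `(ε zS, zO)` (BOUNDEDNESS.md
§6.5 (ii) / GAP-RK: «DNUM … min z_S-degree = 2n_h + 1 (critical 2n_h) … proof still open in general» — the lower bound, proved).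
[cite: AoyamaEtAl2006, §3.2 («Since V_S is a higher order term in ε, its addition … does not affect the UV-limit») and §3.3; CvitanovicKinoshita1974b §II B eqs. (2.11), (2.17)] -/
theorem DNUM_dvd (hI : 0 < Fintype.card κI) (msq : μS ⊕ μO → R) (psq ε : R) :
    ε ^ (2 * Fintype.card κI + 1) ∣ DNUM TI TOS TOO zS zO χS χO msq psq ε := by
  rw [DNUM_eq TI TOS TOO zS zO χS χO hI, pow_succ]
  exact mul_dvd_mul_left _ (eps_dvd_dnumCof TI TOS TOO zS zO χS χO msq psq ε)

/-- **On the mass shell** (`m_i² = m² χ_i²`, `p² = m²`, `VNum_onShell`): `DNUM = m² · (G_G·U_S U_{G/S} − G_S·U_G U_{G/S} − G_{G/S}·U_G U_S)` with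
`G = wᵀ adj(U_st) w`, so the same divisibility holds for the on-shell `V = m² G/U` of the cell's Set-V integrands.
[cite: CvitanovicKinoshita1974b, §IV A (remark after eq. (4.16)); AoyamaEtAl2006 §3.2] -/
theorem DNUM_onShell (msq : μS ⊕ μO → R) (m2 ε : R) (h : ∀ c, msq c = m2 * (uvχ χS χO c * uvχ χS χO c)) :
    DNUM TI TOS TOO zS zO χS χO msq m2 ε =
      m2 * (GQuad (adaptedT TI TOS TOO) (scaledZ zS zO ε) (uvχ χS χO) * (UDet TI (fun b => ε * zS b) * UDet TOO zO)
        - GQuad TI (fun b => ε * zS b) χS * (UDet (adaptedT TI TOS TOO) (scaledZ zS zO ε) * UDet TOO zO)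
        - GQuad TOO zO χO * (UDet (adaptedT TI TOS TOO) (scaledZ zS zO ε) * UDet TI (fun b => ε * zS b))) := by
  have hS : ∀ b, (fun b => msq (Sum.inl b)) b = m2 * (χS b * χS b) := fun b => by simpa [uvχ] using h (Sum.inl b)
  have hO : ∀ c, (fun c => msq (Sum.inr c)) c = m2 * (χO c * χO c) := fun c => by simpa [uvχ] using h (Sum.inr c)
  rw [DNUM, VNum_onShell _ _ _ _ _ h, VNum_onShell _ _ _ _ _ hS, VNum_onShell _ _ _ _ _ hO]
  ring

end Remainders

end Literature.MathematicalPhysics.QuantumFieldTheory.AoyamaEtAl2006
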